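import Summits.CriticalPhenomena.Ising3D.ExclusionSentencesControl2DTrgGammaFin

/-!
# Exclusion sentences — rule R3 ("survives the next certified digit") for the FULL `TRG` table, in kernel form
(cell `pub-ising3x`, seat recog-1, gen 6)

HONEST FRAMING: lottery ticket; floor = tightest certified 3D Ising CFT bounds; no exact-solution
claim without a proof.

`ExclusionSentencesControl2DZeta.lean` has the refinement lemma for `LIN` (`not_mem_linFamily_of_refine`): a COMPLETE
member list on `[a, b]` settles every sub-interval `[a', b']` by checking only the listed tuples' enclosures — no second
table scan.  This file gives the same for the whole `TRG` table (`trgFullFamily`, with the `Γ(¼)`/`Γ(⅓)` powers), whose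
full sentence costs eight `trgFullPart` evaluations (≈ 6 min of kernel time in two files) per interval:
* `trgGTupleEncl e` — rational enclosure of a listed tuple's value (`trgGTupleVal_mem_encl`);
* `trgGTuplesRefine a' b' ex ex'` — every tuple of `ex` is kept in `ex'` or lies decidably OUTSIDE `[a', b']`;
* **`trgFull_listed_of_refine`** — from `trgFullExcluded D h a b ex = true`, `[a', b'] ⊆ [a, b]` and the refine check,
  every member of `trgFullFamily D h` in `[a', b']` is the value of a tuple of `ex'`; **`not_mem_trgFullFamily_of_refine`**
  is the case `ex' = []`.
2D-control instance (no new table scan): from the landed four-member list at `Δ_σ = 1/8 ± 10⁻⁶` (`trgFull_control_sigma`,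
`controlSigmaTrgGEx`) the kernel derives in milliseconds that NO member lies within `10⁻⁷` of `1/8`
(`control_sigma7_not_trgFull_refined`; the eight-part re-scan at `10⁻⁸` is `trgFull_control_sigma8`).  Phase-1 use: successive
certified rungs of one datum re-use the first rung's complete list.  No 3D digit is used anywhere.
-/

namespace Summit.CriticalPhenomena.Ising3D

/-- Rational enclosure of a listed full-TRG tuple's value `(p/q) · trgGVal u a g b L s`. -/
def trgGTupleEncl (e : ℕ × ℕ × ℕ × ℤ × ℕ × ℤ × ℕ × ℤ) : ℚ × ℚ :=
  ((e.1 : ℚ) / e.2.1 * (trgGEncl e.2.2.1 e.2.2.2.1 e.2.2.2.2.1 e.2.2.2.2.2.1 e.2.2.2.2.2.2.1 e.2.2.2.2.2.2.2).1,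
   (e.1 : ℚ) / e.2.1 * (trgGEncl e.2.2.1 e.2.2.2.1 e.2.2.2.2.1 e.2.2.2.2.2.1 e.2.2.2.2.2.2.1 e.2.2.2.2.2.2.2).2)

/-- Soundness of `trgGTupleEncl`. -/
theorem trgGTupleVal_mem_encl (e : ℕ × ℕ × ℕ × ℤ × ℕ × ℤ × ℕ × ℤ) :
    trgGTupleVal e ∈ InI (trgGTupleEncl e) := by
  obtain ⟨⟨h1, h2⟩, _⟩ := trgGVal_mem e.2.2.1 e.2.2.2.1 e.2.2.2.2.1 e.2.2.2.2.2.1 e.2.2.2.2.2.2.1 e.2.2.2.2.2.2.2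
  have hpq : (0 : ℝ) ≤ (e.1 : ℝ) / e.2.1 := by positivity
  refine ⟨?_, ?_⟩
  · simp only [trgGTupleEncl, trgGTupleVal]; push_cast
    exact mul_le_mul_of_nonneg_left h1 hpq
  · simp only [trgGTupleEncl, trgGTupleVal]; push_cast
    exact mul_le_mul_of_nonneg_left h2 hpq

/-- Refinement check: every tuple of `ex` is in the kept list `ex'` or has its enclosure decidably OUTSIDE `[a', b']`. -/
def trgGTuplesRefine (a' b' : ℚ) (ex ex' : List (ℕ × ℕ × ℕ × ℤ × ℕ × ℤ × ℕ × ℤ)) : Bool :=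
  ex.all fun e => ex'.elem e || decide ((trgGTupleEncl e).2 < a') || decide (b' < (trgGTupleEncl e).1)

/-- Soundness of `trgGTuplesRefine`: a tuple of `ex` whose value lies in `[a', b']` is in `ex'`. -/
theorem mem_of_trgGTuplesRefine {a' b' : ℚ} {ex ex' : List (ℕ × ℕ × ℕ × ℤ × ℕ × ℤ × ℕ × ℤ)}
    (h : trgGTuplesRefine a' b' ex ex' = true) {e : ℕ × ℕ × ℕ × ℤ × ℕ × ℤ × ℕ × ℤ} (he : e ∈ ex)
    (hin : (a' : ℝ) ≤ trgGTupleVal e ∧ trgGTupleVal e ≤ b') : e ∈ ex' := by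
  unfold trgGTuplesRefine at h
  have h1 := List.all_eq_true.mp h e he
  simp only [Bool.or_eq_true, List.elem_eq_mem, decide_eq_true_eq] at h1
  obtain ⟨hv1, hv2⟩ := trgGTupleVal_mem_encl e
  rcases h1 with (h1 | h1) | h1
  · exact h1
  · have h3 : (((trgGTupleEncl e).2 : ℚ) : ℝ) < (a' : ℝ) := Rat.cast_lt.mpr h1
    exact absurd hin.1 (not_le.mpr (lt_of_le_of_lt hv2 h3))
  · have h3 : ((b' : ℚ) : ℝ) < (((trgGTupleEncl e).1 : ℚ) : ℝ) := Rat.cast_lt.mpr h1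
    exact absurd hin.2 (not_le.mpr (lt_of_lt_of_le h3 hv1))

/-- **Refinement (rule R3 in kernel form) for the whole TRG table.**  A complete member list `ex` on `[a, b]` and the
refine check for a sub-interval `[a', b'] ⊆ [a, b]` give: every member of `trgFullFamily D h` in `[a', b']` is the value of
a tuple of the kept list `ex'` — no new table scan. -/
theorem trgFull_listed_of_refine {D h : ℕ} {a b a' b' : ℚ} {ex ex' : List (ℕ × ℕ × ℕ × ℤ × ℕ × ℤ × ℕ × ℤ)}
    (hc : trgFullExcluded D h a b ex = true) (ha : a ≤ a') (hb : b' ≤ b)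
    (hout : trgGTuplesRefine a' b' ex ex' = true) {x : ℝ} (hx : (a' : ℝ) ≤ x ∧ x ≤ b')
    (hm : x ∈ trgFullFamily D h) : ∃ e ∈ ex', x = trgGTupleVal e := by
  have ha' : ((a : ℚ) : ℝ) ≤ a' := Rat.cast_le.mpr ha
  have hb' : ((b' : ℚ) : ℝ) ≤ b := Rat.cast_le.mpr hb
  obtain ⟨e, he, hxe⟩ := trgFullExcluded_sound hc ⟨ha'.trans hx.1, hx.2.trans hb'⟩ hm
  exact ⟨e, mem_of_trgGTuplesRefine hout he (hxe ▸ hx), hxe⟩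

/-- The case `ex' = []`: the sub-interval contains NO member of the whole TRG table. -/
theorem not_mem_trgFullFamily_of_refine {D h : ℕ} {a b a' b' : ℚ} {ex : List (ℕ × ℕ × ℕ × ℤ × ℕ × ℤ × ℕ × ℤ)}
    (hc : trgFullExcluded D h a b ex = true) (ha : a ≤ a') (hb : b' ≤ b)
    (hout : trgGTuplesRefine a' b' ex [] = true) {x : ℝ} (hx : (a' : ℝ) ≤ x ∧ x ≤ b') :
    x ∉ trgFullFamily D h := by
  intro hm
  obtain ⟨e, he, _⟩ := trgFull_listed_of_refine hc ha hb hout hx hm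
  simp at he

/-! ### 2D-control instance: one digit after the blind width, by refinement only -/

/-- Each of the four full-TRG members within `10⁻⁶` of `1/8` (`controlSigmaTrgGEx`) lies decidably OUTSIDE
`[1/8 − 10⁻⁷, 1/8 + 10⁻⁷]` (milliseconds of kernel time; no table scan). -/
theorem trgGTuplesRefine_control_sigma7 :
    trgGTuplesRefine (1 / 8 - 1 / 10 ^ 7) (1 / 8 + 1 / 10 ^ 7) controlSigmaTrgGEx [] = true := by
  decide +kernel

/-- … and the check is not vacuous: against the blind-width interval itself (where the four members DO lie) it fails. -/
theorem trgGTuplesRefine_control_sigma6_false :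
    trgGTuplesRefine (1 / 8 - 1 / 10 ^ 6) (1 / 8 + 1 / 10 ^ 6) controlSigmaTrgGEx [] = false := by
  decide +kernel

/-- **Rule R3 at the 2D control, by refinement**: no member of the whole TRG table (`D ≤ 17`, `h ≤ 32`) lies within `10⁻⁷`
of `Δ_σ = 1/8` — derived from the landed complete list at `10⁻⁶` (`trgFull_control_sigma`) without re-scanning the table. -/
theorem control_sigma7_not_trgFull_refined {x : ℝ}
    (hx : ((1 / 8 - 1 / 10 ^ 7 : ℚ) : ℝ) ≤ x ∧ x ≤ ((1 / 8 + 1 / 10 ^ 7 : ℚ) : ℝ)) : x ∉ trgFullFamily 17 32 :=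
  not_mem_trgFullFamily_of_refine trgFull_control_sigma (by norm_num) (by norm_num) trgGTuplesRefine_control_sigma7 hx

end Summit.CriticalPhenomena.Ising3D
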